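import Summits.KontsevichZagierPeriods.Zeta5Search.Certificates.PolyKronecker

/-!
# Polynomial identity testing in the kernel by one Kronecker evaluation — SIX variables (cell `pub-zeta5`, certifier `cert-2`)

HONEST FRAMING: systematic search; recurrence certificates; no irrationality claim unless certified.

cert-1's `Certificates/PolyKronecker.lean` decides `peval e [a,b,c] = 0` for a reflected ring expression `e` in three variables by
ONE evaluation at a Kronecker point.  This file is the same tool for expressions in SIX variables `v₀,…,v₅` (needed for the
parametric creative-telescoping identities of Zudilin's two-tale identity (bmiss), which live in `ℤ[a,b,e,f,g,t]`, fam-tele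
`certs/tele/bmiss_general`): `toMv6`, the structural degree / 1-norm bounds transported to six variables, the mixed-radix index
`kIndex6` and its injectivity on the degree box, the Kronecker point `kronPoint6 e = [β^{s₀},…,β^{s₄},β]`
(`β = normB e + 1`, strides from `degB`), and the tests `peval_eq_zero_of_kron6` / `peval_eq_of_kron6`
(hypotheses by `decide +kernel`). General tooling; no named facts.
-/

namespace Summit.KontsevichZagierPeriods.Zeta5Search.Certificates

namespace PolyReflect

open Lean.Grind.CommRing (Expr Var)
open MvPolynomial Finset

/-! ### The integer polynomial of an expression in six variables -/

/-- The polynomial `toMv6 e ∈ ℤ[v₀,…,v₅]` (as an `MvPolynomial ℕ ℤ`) denoted by `e`. -/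
noncomputable def toMv6 (e : Expr) : MvPolynomial ℕ ℤ := peval e [X 0, X 1, X 2, X 3, X 4, X 5]

/-- `peval e [a₀,…,a₅]` is the evaluation of `toMv6 e`. -/
theorem peval_eq_eval₂_toMv6 {R : Type*} [CommRing R] (e : Expr) (a₀ a₁ a₂ a₃ a₄ a₅ : R) :
    peval e [a₀, a₁, a₂, a₃, a₄, a₅] =
      eval₂Hom (Int.castRingHom R) (fun i => [a₀, a₁, a₂, a₃, a₄, a₅].getD i 0) (toMv6 e) := by
  rw [toMv6, map_peval]
  simp

/-- `toMv6` on sums. -/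
theorem toMv6_add (a b : Expr) : toMv6 (.add a b) = toMv6 a + toMv6 b := peval_add _ a b
/-- `toMv6` on differences. -/
theorem toMv6_sub (a b : Expr) : toMv6 (.sub a b) = toMv6 a - toMv6 b := peval_sub _ a b
/-- `toMv6` on products. -/
theorem toMv6_mul (a b : Expr) : toMv6 (.mul a b) = toMv6 a * toMv6 b := peval_mul _ a b
/-- `toMv6` on negations. -/
theorem toMv6_neg (a : Expr) : toMv6 (.neg a) = -toMv6 a := peval_neg _ a
/-- `toMv6` on powers. -/
theorem toMv6_pow (a : Expr) (k : ℕ) : toMv6 (.pow a k) = toMv6 a ^ k := peval_pow _ a k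
/-- `toMv6` on numerals. -/
theorem toMv6_num (k : ℤ) : toMv6 (.num k) = C k := by
  rw [toMv6, peval_num]; exact (map_intCast (C : ℤ →+* MvPolynomial ℕ ℤ) k).symm
/-- `toMv6` on natural-number casts. -/
theorem toMv6_natCast (k : ℕ) : toMv6 (.natCast k) = C (k : ℤ) := by
  rw [toMv6, peval_natCast]; exact (map_natCast (C : ℤ →+* MvPolynomial ℕ ℤ) k).symm
/-- `toMv6` on integer casts. -/
theorem toMv6_intCast (k : ℤ) : toMv6 (.intCast k) = C k := by
  rw [toMv6, peval_intCast]; exact (map_intCast (C : ℤ →+* MvPolynomial ℕ ℤ) k).symm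
/-- `toMv6` on the six variables. -/
theorem toMv6_var (j : ℕ) (hj : j < 6) : toMv6 (.var j) = X j := by
  rw [toMv6, peval_var]
  interval_cases j <;> rfl

/-- **Degree bound**: `degreeOf i (toMv6 e) ≤ degB i e` for expressions in `v₀,…,v₅`. -/
theorem degreeOf_toMv6_le (i : ℕ) : ∀ e : Expr, varsLT 6 e = true → degreeOf i (toMv6 e) ≤ degB i e
  | .num k, _ => by rw [toMv6_num, degreeOf_C]; exact Nat.zero_le _
  | .natCast k, _ => by rw [toMv6_natCast, degreeOf_C]; exact Nat.zero_le _
  | .intCast k, _ => by rw [toMv6_intCast, degreeOf_C]; exact Nat.zero_le _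
  | .var j, hv => by
      simp only [varsLT, decide_eq_true_eq] at hv
      rw [toMv6_var j hv, degreeOf_X, degB]
      by_cases h : i = j
      · subst h; simp
      · simp [h, Ne.symm h]
  | .neg a, hv => by
      simp only [varsLT] at hv
      rw [toMv6_neg, degreeOf_neg]; exact degreeOf_toMv6_le i a hv
  | .add a b, hv => by
      simp only [varsLT, Bool.and_eq_true] at hv
      rw [toMv6_add, degB]
      exact (degreeOf_add_le i _ _).trans (max_le_max (degreeOf_toMv6_le i a hv.1) (degreeOf_toMv6_le i b hv.2))
  | .sub a b, hv => by
      simp only [varsLT, Bool.and_eq_true] at hv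
      rw [toMv6_sub, degB]
      exact (degreeOf_sub_le i _ _).trans (max_le_max (degreeOf_toMv6_le i a hv.1) (degreeOf_toMv6_le i b hv.2))
  | .mul a b, hv => by
      simp only [varsLT, Bool.and_eq_true] at hv
      rw [toMv6_mul, degB]
      exact (degreeOf_mul_le i _ _).trans (Nat.add_le_add (degreeOf_toMv6_le i a hv.1) (degreeOf_toMv6_le i b hv.2))
  | .pow a k, hv => by
      simp only [varsLT] at hv
      rw [toMv6_pow, degB]
      exact (degreeOf_pow_le i _ k).trans (Nat.mul_le_mul_left k (degreeOf_toMv6_le i a hv))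

/-- **Norm bound**: `L1 (toMv6 e) ≤ normB e` for expressions in `v₀,…,v₅`. -/
theorem L1_toMv6_le : ∀ e : Expr, varsLT 6 e = true → L1 (toMv6 e) ≤ normB e
  | .num k, _ => by rw [toMv6_num]; exact L1_C k
  | .natCast k, _ => by rw [toMv6_natCast, normB]; exact (L1_C _).trans (by simp)
  | .intCast k, _ => by rw [toMv6_intCast]; exact L1_C k
  | .var j, hv => by
      simp only [varsLT, decide_eq_true_eq] at hv
      rw [toMv6_var j hv]; exact L1_X j
  | .neg a, hv => by simp only [varsLT] at hv; rw [toMv6_neg, L1_neg]; exact L1_toMv6_le a hv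
  | .add a b, hv => by
      simp only [varsLT, Bool.and_eq_true] at hv
      rw [toMv6_add, normB]; exact (L1_add _ _).trans (Nat.add_le_add (L1_toMv6_le a hv.1) (L1_toMv6_le b hv.2))
  | .sub a b, hv => by
      simp only [varsLT, Bool.and_eq_true] at hv
      rw [toMv6_sub, normB]; exact (L1_sub _ _).trans (Nat.add_le_add (L1_toMv6_le a hv.1) (L1_toMv6_le b hv.2))
  | .mul a b, hv => by
      simp only [varsLT, Bool.and_eq_true] at hv
      rw [toMv6_mul, normB]; exact (L1_mul _ _).trans (Nat.mul_le_mul (L1_toMv6_le a hv.1) (L1_toMv6_le b hv.2))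
  | .pow a k, hv => by
      simp only [varsLT] at hv
      rw [toMv6_pow, normB]; exact (L1_pow _ k).trans (Nat.pow_le_pow_left (L1_toMv6_le a hv) k)

/-! ### Mixed radix in six digits and the Kronecker point -/

/-- Mixed-radix index of an exponent vector supported on `{0,…,5}` (strides `s₀,…,s₄`, last stride `1`). -/
def kIndex6 (s₀ s₁ s₂ s₃ s₄ : ℕ) (m : ℕ →₀ ℕ) : ℕ := m 0 * s₀ + m 1 * s₁ + m 2 * s₂ + m 3 * s₃ + m 4 * s₄ + m 5

/-- The Kronecker base `β = normB e + 1`. -/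
def kron6Base (e : Expr) : ℕ := normB e + 1
/-- Stride of `v₄`: `degB 5 e + 1`. -/
def kron6S4 (e : Expr) : ℕ := degB 5 e + 1
/-- Stride of `v₃`. -/
def kron6S3 (e : Expr) : ℕ := kron6S4 e * (degB 4 e + 1)
/-- Stride of `v₂`. -/
def kron6S2 (e : Expr) : ℕ := kron6S3 e * (degB 3 e + 1)
/-- Stride of `v₁`. -/
def kron6S1 (e : Expr) : ℕ := kron6S2 e * (degB 2 e + 1)
/-- Stride of `v₀`. -/
def kron6S0 (e : Expr) : ℕ := kron6S1 e * (degB 1 e + 1)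

/-- **The Kronecker point** `[β^{s₀}, β^{s₁}, β^{s₂}, β^{s₃}, β^{s₄}, β]` of `e` (six integers). -/
def kronPoint6 (e : Expr) : List ℤ :=
  [((kron6Base e ^ kron6S0 e : ℕ) : ℤ), ((kron6Base e ^ kron6S1 e : ℕ) : ℤ), ((kron6Base e ^ kron6S2 e : ℕ) : ℤ),
    ((kron6Base e ^ kron6S3 e : ℕ) : ℤ), ((kron6Base e ^ kron6S4 e : ℕ) : ℤ), (kron6Base e : ℤ)]

/-- Peeling one mixed-radix digit: `A·(d+1) + r = B·(d+1) + r'` with `r, r' ≤ d` forces `A = B`. -/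
theorem radix_peel (A B r r' d : ℕ) (hr : r ≤ d) (hr' : r' ≤ d) (h : A * (d + 1) + r = B * (d + 1) + r') :
    A = B := by
  rcases Nat.lt_trichotomy A B with hlt | heq | hgt
  · nlinarith
  · exact heq
  · nlinarith

/-- Injectivity of the six-digit mixed-radix index on the degree box `m i ≤ Dᵢ` (`i = 1..5`; `m 0` free). -/
theorem kIndex6_inj (D₁ D₂ D₃ D₄ D₅ : ℕ) {m m' : ℕ →₀ ℕ}
    (h1 : m 1 ≤ D₁) (h2 : m 2 ≤ D₂) (h3 : m 3 ≤ D₃) (h4 : m 4 ≤ D₄) (h5 : m 5 ≤ D₅)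
    (h1' : m' 1 ≤ D₁) (h2' : m' 2 ≤ D₂) (h3' : m' 3 ≤ D₃) (h4' : m' 4 ≤ D₄) (h5' : m' 5 ≤ D₅)
    (hz : ∀ i, 6 ≤ i → m i = 0) (hz' : ∀ i, 6 ≤ i → m' i = 0)
    (h : kIndex6 ((D₅ + 1) * (D₄ + 1) * (D₃ + 1) * (D₂ + 1) * (D₁ + 1)) ((D₅ + 1) * (D₄ + 1) * (D₃ + 1) * (D₂ + 1))
        ((D₅ + 1) * (D₄ + 1) * (D₃ + 1)) ((D₅ + 1) * (D₄ + 1)) (D₅ + 1) m =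
      kIndex6 ((D₅ + 1) * (D₄ + 1) * (D₃ + 1) * (D₂ + 1) * (D₁ + 1)) ((D₅ + 1) * (D₄ + 1) * (D₃ + 1) * (D₂ + 1))
        ((D₅ + 1) * (D₄ + 1) * (D₃ + 1)) ((D₅ + 1) * (D₄ + 1)) (D₅ + 1) m') : m = m' := by
  unfold kIndex6 at h
  have e : ∀ n : ℕ →₀ ℕ,
      n 0 * ((D₅ + 1) * (D₄ + 1) * (D₃ + 1) * (D₂ + 1) * (D₁ + 1)) + n 1 * ((D₅ + 1) * (D₄ + 1) * (D₃ + 1) * (D₂ + 1))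
        + n 2 * ((D₅ + 1) * (D₄ + 1) * (D₃ + 1)) + n 3 * ((D₅ + 1) * (D₄ + 1)) + n 4 * (D₅ + 1) + n 5
      = ((((n 0 * (D₁ + 1) + n 1) * (D₂ + 1) + n 2) * (D₃ + 1) + n 3) * (D₄ + 1) + n 4) * (D₅ + 1) + n 5 :=
    fun n => by ring
  rw [e m, e m'] at h
  have q4 := radix_peel _ _ _ _ _ h5 h5' h
  have hm5 : m 5 = m' 5 := by rw [q4] at h; exact Nat.add_left_cancel h
  have q3 := radix_peel _ _ _ _ _ h4 h4' q4
  have hm4 : m 4 = m' 4 := by rw [q3] at q4; exact Nat.add_left_cancel q4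
  have q2 := radix_peel _ _ _ _ _ h3 h3' q3
  have hm3 : m 3 = m' 3 := by rw [q2] at q3; exact Nat.add_left_cancel q3
  have q1 := radix_peel _ _ _ _ _ h2 h2' q2
  have hm2 : m 2 = m' 2 := by rw [q1] at q2; exact Nat.add_left_cancel q2
  have hm0 : m 0 = m' 0 := radix_peel _ _ _ _ _ h1 h1' q1
  have hm1 : m 1 = m' 1 := by rw [hm0] at q1; exact Nat.add_left_cancel q1
  ext i
  match i with
  | 0 => exact hm0
  | 1 => exact hm1
  | 2 => exact hm2
  | 3 => exact hm3
  | 4 => exact hm4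
  | 5 => exact hm5
  | i + 6 => rw [hz (i + 6) (by omega), hz' (i + 6) (by omega)]

/-- **Main lemma**: vanishing at the Kronecker point forces `toMv6 e = 0`. -/
theorem toMv6_eq_zero_of_kron (e : Expr) (hv : varsLT 6 e = true) (h0 : peval e (kronPoint6 e) = 0) :
    toMv6 e = 0 := by
  classical
  set p := toMv6 e with hp
  set β := kron6Base e
  set s₄ := kron6S4 e
  set s₃ := kron6S3 e
  set s₂ := kron6S2 e
  set s₁ := kron6S1 e
  set s₀ := kron6S0 e
  have hdeg : ∀ i, ∀ m ∈ p.support, m i ≤ degB i e := fun i =>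
    degreeOf_le_iff.mp (degreeOf_toMv6_le i e hv)
  have hz : ∀ m ∈ p.support, ∀ i, 6 ≤ i → m i = 0 := fun m hm i hi => by
    have := hdeg i m hm; rw [degB_eq_zero 6 i hi e hv] at this; omega
  have hval : peval e (kronPoint6 e) = ∑ m ∈ p.support, p.coeff m * (β : ℤ) ^ kIndex6 s₀ s₁ s₂ s₃ s₄ m := by
    have h := peval_eq_eval₂_toMv6 e (((β ^ s₀ : ℕ) : ℤ)) (((β ^ s₁ : ℕ) : ℤ)) (((β ^ s₂ : ℕ) : ℤ))
      (((β ^ s₃ : ℕ) : ℤ)) (((β ^ s₄ : ℕ) : ℤ)) (β : ℤ)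
    rw [kronPoint6, h, show eval₂Hom (Int.castRingHom ℤ) (fun i => [((β ^ s₀ : ℕ) : ℤ), ((β ^ s₁ : ℕ) : ℤ),
        ((β ^ s₂ : ℕ) : ℤ), ((β ^ s₃ : ℕ) : ℤ), ((β ^ s₄ : ℕ) : ℤ), (β : ℤ)].getD i 0) =
        eval (fun i => [((β ^ s₀ : ℕ) : ℤ), ((β ^ s₁ : ℕ) : ℤ), ((β ^ s₂ : ℕ) : ℤ), ((β ^ s₃ : ℕ) : ℤ),
        ((β ^ s₄ : ℕ) : ℤ), (β : ℤ)].getD i 0) from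
        RingHom.ext fun q => by rw [coe_eval₂Hom, eval, coe_eval₂Hom, RingHom.ext_int (Int.castRingHom ℤ) (RingHom.id ℤ)],
      eval_eq]
    refine sum_congr rfl fun m hm => ?_
    congr 1
    rw [prod_subset (show m.support ⊆ Finset.range 6 from fun i hi => by
          rw [Finset.mem_range]; by_contra h
          exact (Finsupp.mem_support_iff.mp hi) (hz m hm i (Nat.not_lt.mp h)))
        (fun i _ hi => by rw [Finsupp.notMem_support_iff.mp hi, pow_zero])]
    simp only [Finset.prod_range_succ, Finset.prod_range_zero, one_mul, List.getD_cons_zero, List.getD_cons_succ,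
      kIndex6]
    push_cast
    ring
  have hinj : Set.InjOn (kIndex6 s₀ s₁ s₂ s₃ s₄) p.support := fun m hm m' hm' h =>
    kIndex6_inj (degB 1 e) (degB 2 e) (degB 3 e) (degB 4 e) (degB 5 e)
      (hdeg 1 m hm) (hdeg 2 m hm) (hdeg 3 m hm) (hdeg 4 m hm) (hdeg 5 m hm)
      (hdeg 1 m' hm') (hdeg 2 m' hm') (hdeg 3 m' hm') (hdeg 4 m' hm') (hdeg 5 m' hm')
      (hz m hm) (hz m' hm') (by
        simpa [s₀, s₁, s₂, s₃, s₄, kron6S0, kron6S1, kron6S2, kron6S3, kron6S4, mul_comm, mul_assoc, mul_left_comm]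
          using h)
  have hbnd : ∑ m ∈ p.support, (p.coeff m).natAbs < β :=
    Nat.lt_succ_of_le (L1_toMv6_le e hv)
  have hall := digits_eq_zero (kIndex6 s₀ s₁ s₂ s₃ s₄) (fun m => p.coeff m) β p.support hinj (hval ▸ h0) hbnd
  ext m
  rw [coeff_zero]
  by_cases hm : m ∈ p.support
  · exact hall m hm
  · exact notMem_support_iff.mp hm

/-- **Kernel polynomial identity test (six variables)**: an expression in `v₀,…,v₅` that vanishes at its Kronecker point
vanishes identically in every commutative ring. Use `(by decide +kernel)` for both hypotheses. -/
theorem peval_eq_zero_of_kron6 {R : Type*} [CommRing R] (e : Expr) (hv : varsLT 6 e = true)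
    (h0 : peval e (kronPoint6 e) = 0) (a₀ a₁ a₂ a₃ a₄ a₅ : R) : peval e [a₀, a₁, a₂, a₃, a₄, a₅] = 0 := by
  rw [peval_eq_eval₂_toMv6, toMv6_eq_zero_of_kron e hv h0, map_zero]

/-- Two expressions agreeing at the Kronecker point of their difference agree identically (six variables). -/
theorem peval_eq_of_kron6 {R : Type*} [CommRing R] (e₁ e₂ : Expr) (hv : varsLT 6 (.sub e₁ e₂) = true)
    (h0 : peval (.sub e₁ e₂) (kronPoint6 (.sub e₁ e₂)) = 0) (a₀ a₁ a₂ a₃ a₄ a₅ : R) :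
    peval e₁ [a₀, a₁, a₂, a₃, a₄, a₅] = peval e₂ [a₀, a₁, a₂, a₃, a₄, a₅] := by
  have h := peval_eq_zero_of_kron6 (.sub e₁ e₂) hv h0 a₀ a₁ a₂ a₃ a₄ a₅
  rwa [peval_sub, sub_eq_zero] at h

/-! ### Smoke test -/

/-- `(v₀+v₁+v₂+v₃+v₄+v₅)·(v₀−v₅) = v₀² − v₅² + (v₁+v₂+v₃+v₄)(v₀−v₅)` by one integer evaluation in six variables. -/
example (a b c d u v : ℚ) :
    (a + b + c + d + u + v) * (a - v) = a ^ 2 - v ^ 2 + (b + c + d + u) * (a - v) := by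
  let e₁ : Expr := .mul (.add (.add (.add (.add (.add (.var 0) (.var 1)) (.var 2)) (.var 3)) (.var 4)) (.var 5))
    (.sub (.var 0) (.var 5))
  let e₂ : Expr := .add (.sub (.pow (.var 0) 2) (.pow (.var 5) 2))
    (.mul (.add (.add (.add (.var 1) (.var 2)) (.var 3)) (.var 4)) (.sub (.var 0) (.var 5)))
  have h := peval_eq_of_kron6 e₁ e₂ (by decide +kernel) (by decide +kernel) a b c d u v
  have d0 : pvar [a, b, c, d, u, v] 0 = a := rfl
  have d1 : pvar [a, b, c, d, u, v] 1 = b := rfl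
  have d2 : pvar [a, b, c, d, u, v] 2 = c := rfl
  have d3 : pvar [a, b, c, d, u, v] 3 = d := rfl
  have d4 : pvar [a, b, c, d, u, v] 4 = u := rfl
  have d5 : pvar [a, b, c, d, u, v] 5 = v := rfl
  simp only [e₁, e₂, peval_pow, peval_add, peval_sub, peval_mul, peval_var, d0, d1, d2, d3, d4, d5] at h
  linear_combination h

end PolyReflect

end Summit.KontsevichZagierPeriods.Zeta5Search.Certificates
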